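import Literature.AnabelianGeometry.EtaleTheta.ContH1ConjLocallyConstant
import Literature.AnabelianGeometry.EtaleTheta.ThetaSettingToZHat
import HarnessLib

/-!
# [EtTh] Rmk 1.6.4 (c2), towards `a ∈ Ẑ`: every `σ̂ ∈ Π_X` acts on the cocycles of `Π_{Ÿ^∧}`, modulo any open normal
# subgroup of the coefficient group and up to any precision in `Ẑ`, like a TEMPERED `σ ∈ Π^tp_X` (proof-only; (Z5a))

Mochizuki, *The étale theta function …*, Publ. RIMS **45** (2009) [EtTh], Remark 1.6.4 p. 252: «… on which any
`Π_X/Π_{Y^∧} ≅ Ẑ ∋ a` acts via `(η̈^Θ)^∧ ↦ (η̈^Θ)^∧ − 2a·log(Ü) − (a²/2)·log(q_X) + log(O^×_K̈)`»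
[cite: MochizukiEtTh2009, Rmk 1.6.4 p.252]; Neukirch–Schmidt–Wingberg I §5 (the conjugation action on cochains)
[cite: NeukirchSchmidtWingberg2008, I §5].

PROOF-ONLY (abc-iut cell, prover abc-iut-f-128 gen 8; abc-iut-L2-lead gen 9 R1364 KEY «RMK164-ZHAT», piece (Z5a) =
the topology-free APPROXIMATION STEP of the assembly; no definitions, no facts).  Over a theta setting `D`, its profinite
Θ-quotient record `T : D.HatTheta` (abc-iut-f-142) and `Π_X → Ẑ` (`ThetaSetting.toZHat`, abc-iut-f-142 p511642):
* `ThetaSetting.exists_tempered_near` — DENSITY + CONTINUITY: for `σ̂ ∈ Π_X`, any neighbourhood `V` of `1` in `Π_X` and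
  any open `W ⊆ Ẑ` around `toZHat σ̂` there is a TEMPERED `σ ∈ Π^tp_X` with `toHat(σ)·σ̂⁻¹ ∈ V` and `η(toZ σ) ∈ W`;
* `HatTheta.exists_tempered_conjCocycle_congr` — with (Z4) (`ContH1.exists_nhds_forall_conjCocycle_mul_congr`,
  abc-iut p513093; `Π_{Ÿ^∧}` and `ι(Δ_Θ)` compact): for every continuous cocycle `f` on `Π_{Ÿ^∧}` with coefficients
  `ι(Δ_Θ)` (action through `toThetaHat`), every open normal `N` of `((Π^tp_X)^Θ)^∧` and every open `W ∋ toZHat σ̂` there is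
  a tempered `σ` with `η(toZ σ) ∈ W` and `(toHat σ)·f ≡ σ̂·f (mod N)` POINTWISE;
* `HatTheta.exists_tempered_conj_congr` — the class form: `conj_{toHat σ} x` and `conj_{σ̂} x` have representatives
  congruent modulo `N` — so, by abc-iut-w6-d081's `a ∈ ℤ` form (`rmk164_c2_int_H1Hat`, p506713) at the tempered `σ`,
  `σ̂` acts on the profinite theta classes, modulo every `N` and up to any `Ẑ`-precision of `a = toZ σ ≈ toZHat σ̂`,
  by print's formula.  The closed `Ẑ`-form follows from this with `Ẑ`-powers on `ContH1` ((Z3)) and separatedness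
  (`ContH1Separated`, p512078) — (Z5b), not here.
Nothing here bears on [IUTchIII] Cor. 3.12; typed ≠ proved.
-/

noncomputable section

namespace Literature.AnabelianGeometry.EtaleTheta

open scoped IsMulCommutative
open Topology
open Literature.AnabelianGeometry.SemiGraphs

namespace ThetaSetting

variable {p : ℕ} [Fact p.Prime] (D : ThetaSetting p)

/-- **Tempered approximation with controlled `Ẑ`-coordinate**: for `σ̂ ∈ Π_X`, a neighbourhood `V` of `1` in `Π_X` and an
open `W ⊆ Ẑ` containing `toZHat σ̂`, there is `σ ∈ Π^tp_X` with `toHat(σ)·σ̂⁻¹ ∈ V` and `η(toZ σ) ∈ W` (density of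
`toHat(Π^tp_X)` in `Π_X`, continuity of `toZHat`, `toZHat ∘ toHat = η ∘ toZ`). [cite: MochizukiEtTh2009, Rmk 1.6.4 p.252] -/
theorem exists_tempered_near (σh : D.PiHat) {V : Set D.PiHat} (hV : V ∈ 𝓝 (1 : D.PiHat)) {W : Set ZHat}
    (hW : IsOpen W) (hσW : D.toZHat σh ∈ W) :
    ∃ σ : D.PiTemp, D.toHat σ * σh⁻¹ ∈ V ∧ etaZ (D.toZ σ) ∈ W := by
  -- the open neighbourhood `{z | z·σ̂⁻¹ ∈ V} ∩ toZHat⁻¹(W)` of `σ̂` meets the dense `toHat(Π^tp_X)`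
  have h1 : (fun z : D.PiHat => z * σh⁻¹) ⁻¹' V ∈ 𝓝 σh := by
    refine (Continuous.continuousAt (by fun_prop)).preimage_mem_nhds ?_
    simpa only [mul_inv_cancel] using hV
  have h2 : D.toZHat ⁻¹' W ∈ 𝓝 σh := (hW.preimage D.toZHat.continuous).mem_nhds hσW
  obtain ⟨σ, hσ⟩ := D.isProfiniteCompletion_toHat.denseRange.mem_nhds (Filter.inter_mem h1 h2)
  refine ⟨σ, hσ.1, ?_⟩
  have hzW : D.toZHat (D.toHat σ) ∈ W := hσ.2
  rwa [D.toZHat_toHat] at hzW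

namespace HatTheta

variable {D} (T : D.HatTheta)

/-- **`σ̂` acts on cocycles like a nearby tempered `σ`, modulo `N`**: for `σ̂ ∈ Π_X`, a continuous cocycle `f` on
`Π_{Ÿ^∧}` with coefficients `ι(Δ_Θ)` (action through `toThetaHat`), an open normal `N ⊴ ((Π^tp_X)^Θ)^∧` and an open
`W ⊆ Ẑ` around `toZHat σ̂`, there is `σ ∈ Π^tp_X` with `η(toZ σ) ∈ W` and
`((toHat σ)·f)(h) · ((σ̂·f)(h))⁻¹ ∈ N` for every `h ∈ Π_{Ÿ^∧}` — by (Z4) local constancy of the conjugation action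
modulo `N` (`Π_{Ÿ^∧}`, `ι(Δ_Θ)` compact) and the tempered approximation.
[cite: MochizukiEtTh2009, Rmk 1.6.4 p.252] [cite: NeukirchSchmidtWingberg2008, I §5] -/
theorem exists_tempered_conjCocycle_congr [T.DeltaThetaHat.Normal] [D.GtpYddHat.Normal]
    (f : contCocycles T.toThetaHat.toMonoidHom T.DeltaThetaHat D.GtpYddHat) (σh : D.PiHat)
    (N : OpenNormalSubgroup T.GhatTheta) {W : Set ZHat} (hW : IsOpen W) (hσW : D.toZHat σh ∈ W) :
    ∃ σ : D.PiTemp, etaZ (D.toZ σ) ∈ W ∧ ∀ h : D.GtpYddHat,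
      (((ContH1.conjCocycle T.toThetaHat.toMonoidHom T.DeltaThetaHat (D.toHat σ) f).1 h : T.DeltaThetaHat) :
          T.GhatTheta) *
        ((((ContH1.conjCocycle T.toThetaHat.toMonoidHom T.DeltaThetaHat σh f).1 h : T.DeltaThetaHat) :
          T.GhatTheta))⁻¹ ∈ N.toSubgroup := by
  haveI : CompactSpace D.PiHat := D.isProfiniteCompletion_toHat.compactSpace
  have hH : IsCompact ((D.GtpYddHat : Subgroup D.PiHat) : Set D.PiHat) := D.isClosed_gtpYddHat.isCompact
  have hA : IsCompact ((T.DeltaThetaHat : Subgroup T.GhatTheta) : Set T.GhatTheta) :=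
    T.isClosed_deltaThetaHat.isCompact
  obtain ⟨V, hV, hcongr⟩ := ContH1.exists_nhds_forall_conjCocycle_mul_congr (φ := T.toThetaHat.toMonoidHom)
    T.toThetaHat.continuous hA hH f N σh
  obtain ⟨σ, hσV, hσW⟩ := D.exists_tempered_near σh hV hW hσW
  refine ⟨σ, hσW, fun h => ?_⟩
  have key := hcongr (D.toHat σ * σh⁻¹) hσV h
  rwa [inv_mul_cancel_right] at key

/-- **The class form**: for `x ∈ H¹(Π_{Ÿ^∧}, Δ_Θ)` (`T.H1Hat D.GtpYddHat`), `σ̂ ∈ Π_X`, an open normal `N` of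
`((Π^tp_X)^Θ)^∧` and an open `W ∋ toZHat σ̂`, there is a tempered `σ` with `η(toZ σ) ∈ W` such that `conj_{toHat σ} x`
and `conj_{σ̂} x` have representatives that are congruent modulo `N` pointwise.  (With abc-iut-w6-d081's `a ∈ ℤ`
formula for `conj_{toHat σ}`, `a = toZ σ`, this says: `σ̂` acts by print's formula modulo every `N`, up to any
`Ẑ`-precision of `a`.) [cite: MochizukiEtTh2009, Rmk 1.6.4 p.252] -/
theorem exists_tempered_conj_congr [T.DeltaThetaHat.Normal] [D.GtpYddHat.Normal] (x : T.H1Hat D.GtpYddHat)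
    (σh : D.PiHat) (N : OpenNormalSubgroup T.GhatTheta) {W : Set ZHat} (hW : IsOpen W) (hσW : D.toZHat σh ∈ W) :
    ∃ σ : D.PiTemp, etaZ (D.toZ σ) ∈ W ∧
      ∃ f₁ f₂ : contCocycles T.toThetaHat.toMonoidHom T.DeltaThetaHat D.GtpYddHat,
        (QuotientGroup.mk f₁ : T.H1Hat D.GtpYddHat) =
            ContH1.conj T.toThetaHat.toMonoidHom T.DeltaThetaHat (D.toHat σ) x ∧
          (QuotientGroup.mk f₂ : T.H1Hat D.GtpYddHat) =
            ContH1.conj T.toThetaHat.toMonoidHom T.DeltaThetaHat σh x ∧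
          ∀ h : D.GtpYddHat,
            ((f₁.1 h : T.DeltaThetaHat) : T.GhatTheta) * (((f₂.1 h : T.DeltaThetaHat) : T.GhatTheta))⁻¹ ∈
              N.toSubgroup := by
  induction x using QuotientGroup.induction_on with
  | H f =>
    obtain ⟨σ, hσW, hcongr⟩ := T.exists_tempered_conjCocycle_congr f σh N hW hσW
    exact ⟨σ, hσW, ContH1.conjCocycle T.toThetaHat.toMonoidHom T.DeltaThetaHat (D.toHat σ) f,
      ContH1.conjCocycle T.toThetaHat.toMonoidHom T.DeltaThetaHat σh f, rfl, rfl, hcongr⟩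

end HatTheta

end ThetaSetting

end Literature.AnabelianGeometry.EtaleTheta

end
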